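import Summits.QuantumFields.YangMills.Theorems.PoincareLipschitzLatticeToContinuumCoreStep
import Summits.QuantumFields.YangMills.Theorems.PoincareLipschitzLatticeToContinuumSobolevLetters
import HarnessLib

/-!
# LINE 25 «CompactnessTransfer» (K2 crux `BlockLipschitzL` stmt-QuantumFields-23533 ∕ crux of record `HistoryTailL` stmt-QuantumFields-19936), S2♭″ (Γ-KNIT) —
# FILE (K-a) «THE BLOW-DOWN LIMIT IS A LOCAL MINIMISER»: the minimality conjunct of S2♭″ in density form, from the core step ✓(C), GIVEN (i) the recovery
# sequences of the COMPETITOR `V` (the (Γ5) brick's conclusion for `V`, abstract density `densV`), (ii) the ε-form lower semicontinuity row for the limit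
# density `densU` along the blow-down sequence (the (Γ2-lsc) brick's conclusion), (iii) the outer identity `densV = densU` a.e. off every `Q_{s₃}`, `s₃ > s`
# (✓(S) `dens_ae_eq_off_subcube`).  Conclusion: `∫_Q densU ≤ ∫_Q densV`.
# Inner step (Luckhaus 1988 / Simon 1996 §2.9 on ℤ³): for `s⋆ = max s ½ < s₁ < s₂ < s₃` glue the recovery map of `V` (inside `Q_{s₂R}`) to the
# almost-minimiser (outside `Q_{s₁R}`) across a good layer; almost-minimality + lsc give `∫_{Q_{s₁}} densU ≤ ∫_{Q_{s₃}} densV + η`; then `s₁ ↑ s₃`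
# (✓(S) `setIntegral_absCube_le_of_forall_lt`) and the outer identity (✓(S) `setIntegral_cube_le_of_inner_le`).

Cell `ym3-torus` (YM ladder rung R3 = continuum SU(2) Yang–Mills on T³ — a RUNG, NOT the Clay problem: not d = 4, not infinite volume, not a mass gap);
width seat `ym3-torus-px3` gen 8 (the Γ-KNIT pen, LEAD ★w1-19936 g10 12:29:32Z S2♭″ ARCHITECTURE v0).  THEOREMS ONLY (0 `def`, 0 `sorry`);
`--supports stmt-QuantumFields-23533 --as helper`.
* §1 `budget` — the ε-bookkeeping shared with (K-b): the core step's right-hand side is `≤ R·(B + 3η∕4)` under the constants of record.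
* §2 ★★★ `minimality_of_core` — the statement displayed above.
HONEST SCOPE.  One half of the knit (K-a); S2♭″ itself, S1″, `hHalvingBand`, K1, `MeanDeviationL`, `BlockLipschitzL`, `HistoryTailL` are NOT proved here; YM gap NOT proved.

References: S. Luckhaus, Indiana Univ. Math. J. 37 (1988) 349–367, Lemma 1 + Thm 2 [Luckhaus1988]; L. Simon, Theorems on Regularity and Singularity of
Energy Minimizing Maps (1996) §2.9 Lemma 1 (minimality of the limit) [Simon1996].
-/

set_option autoImplicit false

noncomputable section

open scoped BigOperators
open MeasureTheory Set Finset Filter Topology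

namespace Summit.QuantumFields.YangMills.Theorems.PoincareLipschitzLatticeToContinuumMinimality

open Literature.MathematicalPhysics.QuantumFieldTheory.Balaban1983to89
open B4Eq19LatticeOperators (Zd box unitVec mem_box box_mono)
open Summit.QuantumFields.YangMills.Theorems.PoincareLipschitzBlowDownCells (measurable_comp_floorVec)
open Summit.QuantumFields.YangMills.Theorems.PoincareLipschitzSamplingCells (isOpen_absCube)
open Summit.QuantumFields.YangMills.Theorems.PoincareLipschitzLatticeToContinuumLatticeLetters
open Summit.QuantumFields.YangMills.Theorems.PoincareLipschitzLatticeToContinuumCellLetters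
open Summit.QuantumFields.YangMills.Theorems.PoincareLipschitzLatticeToContinuumSobolevLetters
open Summit.QuantumFields.YangMills.Theorems.PoincareLipschitzLatticeToContinuumCoreStep

/-! ## §1 The ε-budget -/

/-- ★ **THE ε-BUDGET.**  Under the constants of record — `N ≥ 4C(Λ₀ + |B| + 1)∕η`, `h ≥ c₁R`, `η′ ≤ min(η∕8, 1, ηc₁²∕(48(C+1)))`, slack `δ ≤ η∕8` on a radius
`T ≤ R` — the right-hand side of ✓`core_step` with `B₂ = B + η′`, `e = e′ = η′` is at most `R·(B + 3η∕4)`. [folklore] -/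
theorem budget {C Λ₀ B η η' c₁ Rr δ T : ℝ} {N h : ℕ} (hC0 : 0 ≤ C) (hRr : 0 < Rr) (hη : 0 < η)
    (hNge : 4 * C * (Λ₀ + |B| + 1) / η ≤ N) (hN : 0 < N) (hc₁ : 0 < c₁) (hhlo : c₁ * Rr ≤ h) (hhpos : (0 : ℝ) < h)
    (hη' : 0 < η') (hη'1 : η' ≤ η / 8) (hη'2 : η' ≤ 1) (hη'3 : η' ≤ η * c₁ ^ 2 / (48 * (C + 1)))
    (hδη : δ ≤ η / 8) (hT0 : 0 ≤ T) (hT : T ≤ Rr) :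
    Rr * (B + η') + C * ((N : ℝ)⁻¹ * (Λ₀ * Rr + Rr * (B + η')) + ((h : ℝ)⁻¹) ^ 2 * (3 * (Rr ^ 3 * (2 * (η' + η'))))) + δ * T
      ≤ Rr * (B + 3 * η / 4) := by
  have hNr : (0 : ℝ) < N := by exact_mod_cast hN
  -- (i) the layer term
  have hlayer : C * ((N : ℝ)⁻¹ * (Λ₀ * Rr + Rr * (B + η'))) ≤ Rr * (η / 4) := by
    have h1 : C * ((N : ℝ)⁻¹ * (Λ₀ * Rr + Rr * (B + η'))) = Rr * (C * (Λ₀ + (B + η')) / N) := by field_simp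
    rw [h1]
    refine mul_le_mul_of_nonneg_left ?_ hRr.le
    have h2 : C * (Λ₀ + (B + η')) ≤ C * (Λ₀ + |B| + 1) := mul_le_mul_of_nonneg_left (by linarith [le_abs_self B]) hC0
    have h3 : C * (Λ₀ + |B| + 1) / N ≤ η / 4 := by
      rw [div_le_iff₀ hNr]
      have := hNge; rw [div_le_iff₀ hη] at this; linarith
    exact (div_le_div_of_nonneg_right h2 hNr.le).trans h3
  -- (ii) the mismatch term
  have hmis : C * (((h : ℝ)⁻¹) ^ 2 * (3 * (Rr ^ 3 * (2 * (η' + η'))))) ≤ Rr * (η / 4) := by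
    have h1 : ((h : ℝ)⁻¹) ^ 2 ≤ ((c₁ * Rr)⁻¹) ^ 2 := by
      have : (c₁ * Rr)⁻¹ ≥ (h : ℝ)⁻¹ := by
        rw [ge_iff_le, inv_le_inv₀ hhpos (by positivity)]; exact hhlo
      exact pow_le_pow_left₀ (by positivity) this 2
    have h2 : C * (((h : ℝ)⁻¹) ^ 2 * (3 * (Rr ^ 3 * (2 * (η' + η'))))) ≤ C * (((c₁ * Rr)⁻¹) ^ 2 * (3 * (Rr ^ 3 * (2 * (η' + η'))))) :=
      mul_le_mul_of_nonneg_left (mul_le_mul_of_nonneg_right h1 (by positivity)) hC0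
    refine h2.trans ?_
    have h3 : C * (((c₁ * Rr)⁻¹) ^ 2 * (3 * (Rr ^ 3 * (2 * (η' + η'))))) = Rr * (12 * C * η' / c₁ ^ 2) := by
      field_simp; ring
    rw [h3]
    refine mul_le_mul_of_nonneg_left ?_ hRr.le
    rw [div_le_iff₀ (by positivity)]
    have h4 := hη'3; rw [le_div_iff₀ (by positivity)] at h4
    have h5 : 12 * C * η' ≤ 12 * (C + 1) * η' := by
      have := mul_le_mul_of_nonneg_right (by linarith : 12 * C ≤ 12 * (C + 1)) hη'.le
      linarith
    calc 12 * C * η' ≤ 12 * (C + 1) * η' := h5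
      _ = η' * (48 * (C + 1)) / 4 := by ring
      _ ≤ η * c₁ ^ 2 / 4 := div_le_div_of_nonneg_right h4 (by norm_num)
      _ = η / 4 * c₁ ^ 2 := by ring
  -- (iii) the slack and the main term
  have hslack : δ * T ≤ Rr * (η / 8) := by
    calc δ * T ≤ (η / 8) * Rr := mul_le_mul hδη hT hT0 (by positivity)
      _ = Rr * (η / 8) := mul_comm _ _
  have hmain : Rr * (B + η') ≤ Rr * B + Rr * (η / 8) := by
    have := mul_le_mul_of_nonneg_left hη'1 hRr.le
    rw [mul_add]; linarith
  rw [mul_add C]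
  linarith [hlayer, hmis, hslack, hmain]

/-! ## §2 The estimate at one good level -/

/-- ★★ **THE ESTIMATE AT ONE GOOD LEVEL.**  At a scale `R` beyond all thresholds, with the recovery map `v` of the competitor `V` at `(s₂, s₃, η′)` in hand and
the blow-down of the almost-minimiser `uk` `η′`-close to `U` in `L²(Q)`: `E_{uk}(Q_{⌈s₁R⌉}(zk)) ≤ R·(B + 3η∕4)` (core step on the shell `[⌈s₁R⌉, s₂R]` cut into
`N` layers of thickness `⌊(s₂−s₁)R∕(2N)⌋`, control set `A = Q_{s₂} ∩ {∃ i, s⋆ ≤ |xᵢ|}`, then the ε-budget). [cite: Luckhaus1988, Lemma 1; Simon1996, §2.9 Lemma 1] -/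
theorem level_bound {C : ℝ} (hC0 : 0 ≤ C)
    (hC : ∀ (u v : Zd 3 → EuclideanSpace ℝ (Fin 4)) (Z z : Zd 3) (R : ℤ) (δ : ℝ),
      (∀ y, ‖u y‖ = 1) → (∀ y, ‖v y‖ = 1) → 0 ≤ δ →
      (∀ (z' : Zd 3) (ρ : ℤ), 0 ≤ ρ → box z' (ρ + 1) ⊆ box Z R →
        ∀ w : Zd 3 → EuclideanSpace ℝ (Fin 4), (∀ y, y ∉ box z' ρ → w y = u y) → (∀ y ∈ box z' ρ, ‖w y‖ = 1) →
        ∑ y ∈ box z' (ρ + 1), ∑ μ : Fin 3, ‖u (y + unitVec μ) - u y‖ ^ 2 ≤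
        (∑ y ∈ box z' (ρ + 1), ∑ μ : Fin 3, ‖w (y + unitVec μ) - w y‖ ^ 2) + δ * ((ρ : ℝ) + 1)) →
      ∀ (a h N : ℕ), 1 ≤ h → 0 < N → box z ((a : ℤ) + N * (h + 1)) ⊆ box Z R →
      ∃ ρ₁ : ℕ, a + (h + 1) ≤ ρ₁ ∧ ρ₁ ≤ a + N * (h + 1) ∧
        ∑ y ∈ box z (ρ₁ : ℤ), ∑ μ : Fin 3, ‖u (y + unitVec μ) - u y‖ ^ 2 ≤
          (∑ y ∈ box z ((ρ₁ : ℤ) - h - 1), ∑ μ : Fin 3, ‖v (y + unitVec μ) - v y‖ ^ 2) +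
          C * ((N : ℝ)⁻¹ * (∑ y ∈ box z ((a : ℤ) + N * (h + 1)), ∑ μ : Fin 3,
                  (‖u (y + unitVec μ) - u y‖ ^ 2 + ‖v (y + unitVec μ) - v y‖ ^ 2)) +
               ((h : ℝ)⁻¹) ^ 2 * (3 * ∑ y ∈ box z ((a : ℤ) + N * (h + 1)) \ box z (a : ℤ), ‖u y - v y‖ ^ 2)) +
          δ * ρ₁)
    {Λ₀ : ℝ} (uk : Zd 3 → EuclideanSpace ℝ (Fin 4)) (zk : Zd 3) {Rz : ℤ} (hRzpos : 0 < Rz)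
    (huk : ∀ y, ‖uk y‖ = 1) {δ : ℝ} (hδ : 0 ≤ δ)
    (hmink : ∀ (z' : Zd 3) (ρ : ℤ), 0 ≤ ρ → box z' (ρ + 1) ⊆ box zk Rz →
        ∀ w : Zd 3 → EuclideanSpace ℝ (Fin 4), (∀ y, y ∉ box z' ρ → w y = uk y) → (∀ y ∈ box z' ρ, ‖w y‖ = 1) →
        ∑ y ∈ box z' (ρ + 1), ∑ μ : Fin 3, ‖uk (y + unitVec μ) - uk y‖ ^ 2 ≤
        (∑ y ∈ box z' (ρ + 1), ∑ μ : Fin 3, ‖w (y + unitVec μ) - w y‖ ^ 2) + δ * ((ρ : ℝ) + 1))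
    (hEk : ∑ y ∈ box zk Rz, ∑ μ : Fin 3, ‖uk (y + unitVec μ) - uk y‖ ^ 2 ≤ Λ₀ * Rz)
    (U : EuclideanSpace ℝ (Fin 3) → EuclideanSpace ℝ (Fin 4)) (hUm : Measurable U) (hU1 : ∀ x, ‖U x‖ = 1)
    (V : EuclideanSpace ℝ (Fin 3) → EuclideanSpace ℝ (Fin 4))
    (hVm : AEStronglyMeasurable V (volume.restrict {x : EuclideanSpace ℝ (Fin 3) | ∀ i : Fin 3, |x i| < 1}))
    (hV1 : ∀ x : EuclideanSpace ℝ (Fin 3), (∀ i : Fin 3, |x i| < 1) → ‖V x‖ = 1)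
    {sS s₁ s₂ B η η' c₁ : ℝ} {N : ℕ} (hsS1 : sS ≤ s₁) (hs₁0 : 0 < s₁) (hs₁₂ : s₁ < s₂) (hs₂1 : s₂ ≤ 1)
    (hVU' : ∀ x : EuclideanSpace ℝ (Fin 3), (∃ i : Fin 3, sS ≤ |x i|) → V x = U x)
    (hη : 0 < η) (hN : 0 < N) (hNge : 4 * C * (Λ₀ + |B| + 1) / η ≤ N) (hc₁_def : c₁ = (s₂ - s₁) / (4 * N))
    (hη' : 0 < η') (hη'1 : η' ≤ η / 8) (hη'2 : η' ≤ 1) (hη'3 : η' ≤ η * c₁ ^ 2 / (48 * (C + 1)))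
    (hδη : δ ≤ η / 8) (hdR : 4 * (N : ℝ) + 8 ≤ (s₂ - s₁) * (Rz : ℝ))
    (hclose : ∫ x in {x : EuclideanSpace ℝ (Fin 3) | ∀ i : Fin 3, |x i| < 1}, ‖uk (zk + fun i => ⌊(Rz : ℝ) * x i⌋) - U x‖ ^ 2 ≤ η')
    (v : Zd 3 → EuclideanSpace ℝ (Fin 4)) (hv1 : ∀ y, ‖v y‖ = 1)
    (hvE : ((Rz : ℝ))⁻¹ * ∑ y ∈ box (0 : Zd 3) ⌊s₂ * (Rz : ℝ)⌋, ∑ μ : Fin 3, ‖v (y + unitVec μ) - v y‖ ^ 2 ≤ B + η')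
    (hvL2 : ∫ x in {x : EuclideanSpace ℝ (Fin 3) | ∀ i : Fin 3, |x i| < s₂}, ‖v (fun i => ⌊(Rz : ℝ) * x i⌋) - V x‖ ^ 2 ≤ η') :
    ∑ y ∈ box zk ⌈s₁ * (Rz : ℝ)⌉, ∑ μ : Fin 3, ‖uk (y + unitVec μ) - uk y‖ ^ 2 ≤ (Rz : ℝ) * (B + 3 * η / 4) := by
  set Rr : ℝ := (Rz : ℝ) with hRr_def
  have hRr : 0 < Rr := by rw [hRr_def]; exact_mod_cast hRzpos
  have hNr : (0 : ℝ) < N := by exact_mod_cast hN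
  have hc₁ : 0 < c₁ := by rw [hc₁_def]; exact div_pos (by linarith) (by positivity)
  -- `a = ⌈s₁R⌉`, `h = ⌊(s₂−s₁)R/(2N)⌋`
  set aZ : ℤ := ⌈s₁ * Rr⌉ with haZ_def
  have haZlo : s₁ * Rr ≤ aZ := Int.le_ceil _
  have haZhi : (aZ : ℝ) ≤ s₁ * Rr + 1 := (Int.ceil_lt_add_one _).le
  have haZ0 : (0 : ℤ) ≤ aZ := by
    have : (0 : ℝ) ≤ (aZ : ℝ) := (mul_pos hs₁0 hRr).le.trans haZlo
    exact_mod_cast this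
  set a : ℕ := aZ.toNat with ha_def
  have ha_eq : (a : ℤ) = aZ := by rw [ha_def, Int.toNat_of_nonneg haZ0]
  have ha_eqr : (a : ℝ) = aZ := by exact_mod_cast ha_eq
  set h : ℕ := ⌊(s₂ - s₁) * Rr / (2 * N)⌋₊ with hh_def
  have hharg : 2 ≤ (s₂ - s₁) * Rr / (2 * N) := by rw [le_div_iff₀ (by positivity)]; linarith
  have hh2 : 2 ≤ h := by rw [hh_def]; exact Nat.le_floor (by exact_mod_cast hharg)
  have hh1 : 1 ≤ h := le_trans (by norm_num) hh2
  have hhr : (h : ℝ) ≤ (s₂ - s₁) * Rr / (2 * N) := Nat.floor_le (by positivity)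
  have hhlo : c₁ * Rr ≤ h := by
    have h1 : (s₂ - s₁) * Rr / (2 * N) - 1 < h := by
      have := Nat.sub_one_lt_floor ((s₂ - s₁) * Rr / (2 * N)); rw [hh_def]; exact this
    have h2 : c₁ * Rr = (s₂ - s₁) * Rr / (2 * N) - (s₂ - s₁) * Rr / (4 * N) := by rw [hc₁_def]; field_simp; ring
    have h3 : 1 ≤ (s₂ - s₁) * Rr / (4 * N) := by rw [le_div_iff₀ (by positivity)]; linarith
    linarith
  have hhpos : (0 : ℝ) < h := by exact_mod_cast (Nat.one_pos.trans_le hh1 : 0 < h)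
  -- the shell fits below `s₂R`
  have htop : ((a + N * (h + 1) : ℕ) : ℝ) + 1 ≤ s₂ * Rr := by
    push_cast
    rw [ha_eqr]
    have hNh : (N : ℝ) * h ≤ (s₂ - s₁) * Rr / 2 := by
      have := mul_le_mul_of_nonneg_left hhr hNr.le
      have h2 : (N : ℝ) * ((s₂ - s₁) * Rr / (2 * N)) = (s₂ - s₁) * Rr / 2 := by field_simp
      linarith
    have hexp : (N : ℝ) * ((h : ℝ) + 1) = N * h + N := by ring
    rw [hexp]
    have hsub : (s₂ - s₁) * Rr = s₂ * Rr - s₁ * Rr := by ring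
    linarith
  -- the control set `A = Q_{s₂} ∩ {∃ i, s⋆ ≤ |xᵢ|}`
  set A : Set (EuclideanSpace ℝ (Fin 3)) := {x | ∀ i : Fin 3, |x i| < s₂} ∩ {x | ∃ i : Fin 3, sS ≤ |x i|} with hA_def
  have hAQ₂ : A ⊆ {x : EuclideanSpace ℝ (Fin 3) | ∀ i : Fin 3, |x i| < s₂} := Set.inter_subset_left
  have hQ₂Q : {x : EuclideanSpace ℝ (Fin 3) | ∀ i : Fin 3, |x i| < s₂} ⊆ {x | ∀ i : Fin 3, |x i| < 1} := fun x hx i => (hx i).trans_le hs₂1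
  have hAQ : A ⊆ {x : EuclideanSpace ℝ (Fin 3) | ∀ i : Fin 3, |x i| < 1} := hAQ₂.trans hQ₂Q
  have hclosed : IsClosed {x : EuclideanSpace ℝ (Fin 3) | ∃ i : Fin 3, sS ≤ |x i|} := by
    have : {x : EuclideanSpace ℝ (Fin 3) | ∃ i : Fin 3, sS ≤ |x i|} = ⋃ i : Fin 3, {x | sS ≤ |x i|} := by ext x; simp
    rw [this]
    exact isClosed_iUnion_of_finite fun i => isClosed_le continuous_const ((EuclideanSpace.proj i).continuous.abs)
  have hA : MeasurableSet A := (isOpen_absCube s₂).measurableSet.inter hclosed.measurableSet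
  have hAfin : volume A < ⊤ := (measure_mono hAQ₂).trans_lt (volume_absCube_lt_top s₂)
  have hUV : ∀ x ∈ A, U x = V x := fun x hx => (hVU' x hx.2).symm
  have hbd_meas : Measurable fun x : EuclideanSpace ℝ (Fin 3) => uk (zk + fun i => ⌊Rr * x i⌋) :=
    measurable_comp_floorVec (fun y => uk (zk + y)) Rr
  have hvd_meas : Measurable fun x : EuclideanSpace ℝ (Fin 3) => v (fun i => ⌊Rr * x i⌋) := measurable_comp_floorVec v Rr
  have hVmS : ∀ {S : Set (EuclideanSpace ℝ (Fin 3))}, S ⊆ {x | ∀ i : Fin 3, |x i| < 1} → MeasurableSet S →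
      AEStronglyMeasurable V (volume.restrict S) ∧ ∀ᵐ x ∂(volume.restrict S), ‖V x‖ ≤ 1 := by
    intro S hS hSm
    exact ⟨hVm.mono_measure (Measure.restrict_mono hS le_rfl), (ae_restrict_iff' hSm).2 (Eventually.of_forall fun x hx => (hV1 x (hS hx)).le)⟩
  have hintU : IntegrableOn (fun x => ‖uk (zk + fun i => ⌊Rr * x i⌋) - U x‖ ^ 2) A volume :=
    integrableOn_normSq_sub_of_bound hAfin hbd_meas.aestronglyMeasurable hUm.aestronglyMeasurable
      (fun x => (huk _).le) (Eventually.of_forall fun x => (hU1 x).le)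
  have hintV : IntegrableOn (fun x => ‖v (fun i => ⌊Rr * x i⌋) - V x‖ ^ 2) A volume :=
    integrableOn_normSq_sub_of_bound hAfin hvd_meas.aestronglyMeasurable (hVmS hAQ hA).1 (fun x => (hv1 _).le) (hVmS hAQ hA).2
  have hintV₂ : IntegrableOn (fun x => ‖v (fun i => ⌊Rr * x i⌋) - V x‖ ^ 2) {x : EuclideanSpace ℝ (Fin 3) | ∀ i : Fin 3, |x i| < s₂} volume :=
    integrableOn_normSq_sub_of_bound (volume_absCube_lt_top s₂) hvd_meas.aestronglyMeasurable
      (hVmS hQ₂Q (isOpen_absCube s₂).measurableSet).1 (fun x => (hv1 _).le) (hVmS hQ₂Q (isOpen_absCube s₂).measurableSet).2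
  have hintU1 : IntegrableOn (fun x => ‖uk (zk + fun i => ⌊Rr * x i⌋) - U x‖ ^ 2) {x : EuclideanSpace ℝ (Fin 3) | ∀ i : Fin 3, |x i| < 1} volume :=
    integrableOn_normSq_sub_of_bound (volume_absCube_lt_top 1) hbd_meas.aestronglyMeasurable hUm.aestronglyMeasurable
      (fun x => (huk _).le) (Eventually.of_forall fun x => (hU1 x).le)
  have heU : ∫ x in A, ‖uk (zk + fun i => ⌊Rr * x i⌋) - U x‖ ^ 2 ≤ η' :=
    (setIntegral_mono_set hintU1 (Eventually.of_forall fun x => by positivity) (Eventually.of_forall hAQ)).trans hclose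
  have heV : ∫ x in A, ‖v (fun i => ⌊Rr * x i⌋) - V x‖ ^ 2 ≤ η' :=
    (setIntegral_mono_set hintV₂ (Eventually.of_forall fun x => by positivity) (Eventually.of_forall hAQ₂)).trans hvL2
  -- the cells of the shell lie in `A`
  have hcells : ∀ y ∈ box zk ((a : ℤ) + N * (h + 1)) \ box zk (a : ℤ),
      {x : EuclideanSpace ℝ (Fin 3) | ∀ i, ⌊Rr * x i⌋ = y i - zk i} ⊆ A := by
    intro y hy x hx
    rw [Finset.mem_sdiff] at hy
    have ha0 : (0 : ℤ) ≤ (a : ℤ) := by positivity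
    have hsh := floorCell_subset_shell hRr ha0 hy.1 hy.2 hx
    refine ⟨fun i => (hsh.1 i).trans_le ?_, ?_⟩
    · rw [div_le_iff₀ hRr]
      have : (((a : ℤ) + N * (h + 1) : ℤ) : ℝ) + 1 = ((a + N * (h + 1) : ℕ) : ℝ) + 1 := by push_cast; ring
      linarith
    · obtain ⟨i, hi⟩ := hsh.2
      refine ⟨i, le_trans ?_ hi⟩
      rw [le_div_iff₀ hRr]
      have h1 : ((a : ℤ) : ℝ) = aZ := by exact_mod_cast ha_eq
      rw [h1]
      have h2 : sS * Rr ≤ s₁ * Rr := mul_le_mul_of_nonneg_right hsS1 hRr.le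
      linarith
  -- THE CORE STEP + THE BUDGET
  have core := core_step hC0 hC uk v huk hv1 zk hRzpos hδ hmink hEk
    hs₂1 hvE U V hA hAfin hUV hintU hintV heU heV a h N hh1 hN htop hcells
  have hT0 : (0 : ℝ) ≤ (a : ℝ) + N * (h + 1) := by positivity
  have hT : (a : ℝ) + N * (h + 1) ≤ Rr := by
    have h0 : ((a + N * (h + 1) : ℕ) : ℝ) + 1 ≤ s₂ * Rr := htop
    push_cast at h0
    have : s₂ * Rr ≤ Rr := mul_le_of_le_one_left hRr.le hs₂1
    linarith
  have hbud := budget (B := B) (Λ₀ := Λ₀) hC0 hRr hη hNge hN hc₁ hhlo hhpos hη' hη'1 hη'2 hη'3 hδη hT0 hT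
  rw [← ha_eq]
  exact core.trans hbud

/-! ## §3 ★★★ Minimality of the limit -/

/-- ★★★ **(K-a) THE BLOW-DOWN LIMIT IS A LOCAL MINIMISER (density form).**  Let `C ≥ 0` satisfy ✓`exists_glued_competitor_le`'s conclusion; `(u k, z k, R k)`
S2♭″'s almost-minimising unit lattice sequence; `φ` strictly increasing; `U` measurable, everywhere unit, with `∫_Q‖u(φk)(z(φk)+⌊R(φk)x⌋) − U‖² → 0`; `densU`
integrable on `Q` with the ε-lsc row along `φ` (the (Γ2-lsc) conclusion); a competitor `V` (a.e.-strongly measurable on `Q`, unit on `Q`, `V = U` wherever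
`∃ i, s ≤ |xᵢ|`, `s < 1`) with integrable density `densV`, `densV = densU` a.e. on `Q ∖ Q_{s₃}` for all `s₃ > s`, admitting unit lattice RECOVERY MAPS
(the (Γ5) conclusion for `V`).  Then `∫_Q densU ≤ ∫_Q densV`. [cite: Luckhaus1988, Lemma 1 + Thm 2; Simon1996, §2.9 Lemma 1] -/
theorem minimality_of_core {C : ℝ} (hC0 : 0 ≤ C)
    (hC : ∀ (u v : Zd 3 → EuclideanSpace ℝ (Fin 4)) (Z z : Zd 3) (R : ℤ) (δ : ℝ),
      (∀ y, ‖u y‖ = 1) → (∀ y, ‖v y‖ = 1) → 0 ≤ δ →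
      (∀ (z' : Zd 3) (ρ : ℤ), 0 ≤ ρ → box z' (ρ + 1) ⊆ box Z R →
        ∀ w : Zd 3 → EuclideanSpace ℝ (Fin 4), (∀ y, y ∉ box z' ρ → w y = u y) → (∀ y ∈ box z' ρ, ‖w y‖ = 1) →
        ∑ y ∈ box z' (ρ + 1), ∑ μ : Fin 3, ‖u (y + unitVec μ) - u y‖ ^ 2 ≤
        (∑ y ∈ box z' (ρ + 1), ∑ μ : Fin 3, ‖w (y + unitVec μ) - w y‖ ^ 2) + δ * ((ρ : ℝ) + 1)) →
      ∀ (a h N : ℕ), 1 ≤ h → 0 < N → box z ((a : ℤ) + N * (h + 1)) ⊆ box Z R →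
      ∃ ρ₁ : ℕ, a + (h + 1) ≤ ρ₁ ∧ ρ₁ ≤ a + N * (h + 1) ∧
        ∑ y ∈ box z (ρ₁ : ℤ), ∑ μ : Fin 3, ‖u (y + unitVec μ) - u y‖ ^ 2 ≤
          (∑ y ∈ box z ((ρ₁ : ℤ) - h - 1), ∑ μ : Fin 3, ‖v (y + unitVec μ) - v y‖ ^ 2) +
          C * ((N : ℝ)⁻¹ * (∑ y ∈ box z ((a : ℤ) + N * (h + 1)), ∑ μ : Fin 3,
                  (‖u (y + unitVec μ) - u y‖ ^ 2 + ‖v (y + unitVec μ) - v y‖ ^ 2)) +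
               ((h : ℝ)⁻¹) ^ 2 * (3 * ∑ y ∈ box z ((a : ℤ) + N * (h + 1)) \ box z (a : ℤ), ‖u y - v y‖ ^ 2)) +
          δ * ρ₁)
    {Λ₀ : ℝ}
    (u : ℕ → Zd 3 → EuclideanSpace ℝ (Fin 4)) (z : ℕ → Zd 3) (R : ℕ → ℤ)
    (hR : ∀ k : ℕ, (k : ℝ) + 1 ≤ R k) (hu : ∀ (k : ℕ) (y : Zd 3), ‖u k y‖ = 1)
    (hmin : ∀ k : ℕ, (∀ (z' : Zd 3) (ρ : ℤ), 0 ≤ ρ → box z' (ρ + 1) ⊆ box (z k) (R k) →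
        ∀ v : Zd 3 → EuclideanSpace ℝ (Fin 4), (∀ y, y ∉ box z' ρ → v y = (u k) y) → (∀ y ∈ box z' ρ, ‖v y‖ = 1) →
        ∑ y ∈ box z' (ρ + 1), ∑ μ : Fin 3, ‖(u k) (y + unitVec μ) - (u k) y‖ ^ 2 ≤
        (∑ y ∈ box z' (ρ + 1), ∑ μ : Fin 3, ‖v (y + unitVec μ) - v y‖ ^ 2) + (1 / ((k : ℝ) + 1)) * ((ρ : ℝ) + 1)))
    (hE : ∀ k : ℕ, ∑ y ∈ box (z k) (R k), ∑ μ : Fin 3, ‖(u k) (y + unitVec μ) - (u k) y‖ ^ 2 ≤ Λ₀ * R k)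
    (φ : ℕ → ℕ) (hφ : StrictMono φ)
    (U : EuclideanSpace ℝ (Fin 3) → EuclideanSpace ℝ (Fin 4)) (hUm : Measurable U) (hU1 : ∀ x, ‖U x‖ = 1)
    (hconv : Tendsto (fun k : ℕ => ∫ x in {x : EuclideanSpace ℝ (Fin 3) | ∀ i : Fin 3, |x i| < 1},
        ‖u (φ k) (z (φ k) + fun i => ⌊(R (φ k) : ℝ) * x i⌋) - U x‖ ^ 2) atTop (𝓝 0))
    (densU : EuclideanSpace ℝ (Fin 3) → ℝ) (hdensU : IntegrableOn densU {x : EuclideanSpace ℝ (Fin 3) | ∀ i : Fin 3, |x i| < 1} volume)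
    (hlscU : ∀ (t ε : ℝ), 0 < t → t ≤ 1 → 0 < ε → ∃ k₀ : ℕ, ∀ k : ℕ, k₀ ≤ k →
        ∫ x in {x : EuclideanSpace ℝ (Fin 3) | ∀ i : Fin 3, |x i| < t}, densU x ≤
          (R (φ k) : ℝ)⁻¹ * (∑ y ∈ box (z (φ k)) ⌈t * (R (φ k) : ℝ)⌉, ∑ μ : Fin 3, ‖(u (φ k)) (y + unitVec μ) - (u (φ k)) y‖ ^ 2) + ε)
    (V : EuclideanSpace ℝ (Fin 3) → EuclideanSpace ℝ (Fin 4))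
    (hVm : AEStronglyMeasurable V (volume.restrict {x : EuclideanSpace ℝ (Fin 3) | ∀ i : Fin 3, |x i| < 1}))
    (hV1 : ∀ x : EuclideanSpace ℝ (Fin 3), (∀ i : Fin 3, |x i| < 1) → ‖V x‖ = 1)
    {s : ℝ} (hs1 : s < 1) (hVU : ∀ x : EuclideanSpace ℝ (Fin 3), (∃ i : Fin 3, s ≤ |x i|) → V x = U x)
    (densV : EuclideanSpace ℝ (Fin 3) → ℝ) (hdensV : IntegrableOn densV {x : EuclideanSpace ℝ (Fin 3) | ∀ i : Fin 3, |x i| < 1} volume)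
    (hout : ∀ s₃ : ℝ, s < s₃ → ∀ᵐ x ∂(volume.restrict ({x : EuclideanSpace ℝ (Fin 3) | ∀ i : Fin 3, |x i| < 1} \ {x | ∀ i : Fin 3, |x i| < s₃})),
        densV x = densU x)
    (hrec : ∀ (s₁ s' η : ℝ), 0 < s₁ → s₁ < s' → s' < 1 → 0 < η → ∃ R₀ : ℕ, ∀ Rn : ℕ, R₀ ≤ Rn →
        ∃ v : Zd 3 → EuclideanSpace ℝ (Fin 4), (∀ y, ‖v y‖ = 1) ∧
          (Rn : ℝ)⁻¹ * ∑ y ∈ box (0 : Zd 3) ⌊s₁ * Rn⌋, ∑ μ : Fin 3, ‖v (y + unitVec μ) - v y‖ ^ 2 ≤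
            (∫ x in {x : EuclideanSpace ℝ (Fin 3) | ∀ i : Fin 3, |x i| < s'}, densV x) + η ∧
          ∫ x in {x : EuclideanSpace ℝ (Fin 3) | ∀ i : Fin 3, |x i| < s₁}, ‖v (fun i => ⌊(Rn : ℝ) * x i⌋) - V x‖ ^ 2 ≤ η) :
    ∫ x in {x : EuclideanSpace ℝ (Fin 3) | ∀ i : Fin 3, |x i| < 1}, densU x ≤
      ∫ x in {x : EuclideanSpace ℝ (Fin 3) | ∀ i : Fin 3, |x i| < 1}, densV x := by
  -- WLOG the agreement threshold is `s⋆ = max s ½`; fix `s₃ = (s⋆ + 1)/2`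
  set sS : ℝ := max s (1 / 2) with hsS_def
  have hsS1 : sS < 1 := max_lt hs1 (by norm_num)
  have hsS2 : 1 / 2 ≤ sS := le_max_right _ _
  have hVU' : ∀ x : EuclideanSpace ℝ (Fin 3), (∃ i : Fin 3, sS ≤ |x i|) → V x = U x :=
    fun x ⟨i, hi⟩ => hVU x ⟨i, (le_max_left _ _).trans hi⟩
  set s₃ : ℝ := (sS + 1) / 2 with hs₃_def
  have hs₃1 : s₃ < 1 := by rw [hs₃_def]; linarith
  have hsS₃ : sS < s₃ := by rw [hs₃_def]; linarith
  have hQ₃sub : {x : EuclideanSpace ℝ (Fin 3) | ∀ i : Fin 3, |x i| < s₃} ⊆ {x | ∀ i : Fin 3, |x i| < 1} := fun x hx i => (hx i).trans hs₃1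
  set B : ℝ := ∫ x in {x : EuclideanSpace ℝ (Fin 3) | ∀ i : Fin 3, |x i| < s₃}, densV x with hB_def
  -- the outer identity reduces the claim to the inner cube `Q_{s₃}`
  refine setIntegral_cube_le_of_inner_le hdensU hdensV hs₃1.le (hout s₃ ((le_max_left _ _).trans_lt hsS₃)) ?_
  -- the inner cube: a bound on every `Q_{s₁}`, `s⋆ < s₁ < s₃`, by every `η > 0`
  refine setIntegral_absCube_le_of_forall_lt hsS₃ (hdensU.mono_set hQ₃sub) fun s₁ hs₁lo hs₁hi => ?_
  refine le_of_forall_pos_le_add fun η hη => ?_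
  have hs₁0 : 0 < s₁ := by linarith
  have hs₁1 : s₁ ≤ 1 := by linarith
  set s₂ : ℝ := (s₁ + s₃) / 2 with hs₂_def
  have hs₁₂ : s₁ < s₂ := by rw [hs₂_def]; linarith
  have hs₂₃ : s₂ < s₃ := by rw [hs₂_def]; linarith
  have hs₂0 : 0 < s₂ := by linarith
  have hs₂1 : s₂ ≤ 1 := by linarith
  -- constants
  set N : ℕ := ⌈4 * C * (Λ₀ + |B| + 1) / η⌉₊ + 1 with hN_def
  have hN : 0 < N := Nat.succ_pos _
  have hNr : (0 : ℝ) < N := by exact_mod_cast hN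
  have hNge : 4 * C * (Λ₀ + |B| + 1) / η ≤ N := by
    rw [hN_def]; push_cast
    exact (Nat.le_ceil _).trans (by linarith)
  set c₁ : ℝ := (s₂ - s₁) / (4 * N) with hc₁_def
  have hc₁ : 0 < c₁ := by rw [hc₁_def]; exact div_pos (by linarith) (by positivity)
  set η' : ℝ := min (min (η / 8) 1) (η * c₁ ^ 2 / (48 * (C + 1))) with hη'_def
  have hη' : 0 < η' := by positivity
  have hη'1 : η' ≤ η / 8 := (min_le_left _ _).trans (min_le_left _ _)
  have hη'2 : η' ≤ 1 := (min_le_left _ _).trans (min_le_right _ _)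
  have hη'3 : η' ≤ η * c₁ ^ 2 / (48 * (C + 1)) := min_le_right _ _
  -- recovery maps of `V` at `(s₂, s₃, η')`, lsc at `s₁` with `η/8`
  obtain ⟨R₀, hR₀⟩ := hrec s₂ s₃ η' hs₂0 hs₂₃ hs₃1 hη'
  obtain ⟨k₁, hk₁⟩ := hlscU s₁ (η / 8) hs₁0 hs₁1 (by positivity)
  -- thresholds; one good index `k`
  have hRk : Tendsto (fun k : ℕ => (R (φ k) : ℝ)) atTop atTop := by
    refine tendsto_atTop_mono (fun k => ?_) (tendsto_atTop_add_const_right atTop (1 : ℝ) tendsto_natCast_atTop_atTop)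
    have h1 : (k : ℝ) ≤ φ k := by exact_mod_cast hφ.id_le k
    linarith [hR (φ k)]
  have hT1 : ∀ᶠ k : ℕ in atTop, (R₀ : ℝ) ≤ R (φ k) := hRk.eventually_ge_atTop _
  have hT2 : ∀ᶠ k : ℕ in atTop, (4 * N + 8) / (s₂ - s₁) ≤ (R (φ k) : ℝ) := hRk.eventually_ge_atTop _
  have hT3 : ∀ᶠ k : ℕ in atTop, ∫ x in {x : EuclideanSpace ℝ (Fin 3) | ∀ i : Fin 3, |x i| < 1},
      ‖u (φ k) (z (φ k) + fun i => ⌊(R (φ k) : ℝ) * x i⌋) - U x‖ ^ 2 < η' := hconv.eventually (eventually_lt_nhds hη')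
  have hT4 : ∀ᶠ k : ℕ in atTop, 8 / η ≤ (k : ℝ) + 1 :=
    (tendsto_atTop_add_const_right atTop (1 : ℝ) tendsto_natCast_atTop_atTop).eventually_ge_atTop _
  have hT5 : ∀ᶠ k : ℕ in atTop, k₁ ≤ k := eventually_ge_atTop k₁
  obtain ⟨k, hk1, hk2, hk3, hk4, hk5⟩ := (hT1.and (hT2.and (hT3.and (hT4.and hT5)))).exists
  -- the scale at level `k`
  have hRr1 : (1 : ℝ) ≤ (R (φ k) : ℝ) := by
    have := hR (φ k); have h0 : (0:ℝ) ≤ (φ k : ℝ) := Nat.cast_nonneg _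
    linarith
  have hRr : (0 : ℝ) < (R (φ k) : ℝ) := by linarith
  have hRzpos : (0 : ℤ) < R (φ k) := by exact_mod_cast hRr
  set Rn : ℕ := (R (φ k)).toNat with hRn
  have hRn_eq : (Rn : ℝ) = (R (φ k) : ℝ) := by
    rw [← Int.cast_natCast, hRn, Int.toNat_of_nonneg hRzpos.le]
  have hRn0 : R₀ ≤ Rn := by exact_mod_cast (hk1.trans_eq hRn_eq.symm)
  have hdR : 4 * (N : ℝ) + 8 ≤ (s₂ - s₁) * (R (φ k) : ℝ) := by
    have := hk2; rw [div_le_iff₀ (by linarith)] at this; linarith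
  -- the recovery map at this scale
  obtain ⟨v, hv1, hvE, hvL2⟩ := hR₀ Rn hRn0
  rw [hRn_eq] at hvE hvL2
  -- slack
  have hδ : (0 : ℝ) ≤ 1 / ((φ k : ℝ) + 1) := by positivity
  have hδη : 1 / ((φ k : ℝ) + 1) ≤ η / 8 := by
    have hφk : (k : ℝ) ≤ φ k := by exact_mod_cast hφ.id_le k
    rw [div_le_iff₀ (by positivity)]
    have h3 := hk4; rw [div_le_iff₀ hη] at h3
    have h4 : η * ((k : ℝ) + 1) ≤ η * ((φ k : ℝ) + 1) := mul_le_mul_of_nonneg_left (by linarith) hη.le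
    linarith
  -- the level bound
  have hlev := level_bound hC0 hC (u (φ k)) (z (φ k)) hRzpos (hu (φ k)) hδ (hmin (φ k)) (hE (φ k)) U hUm hU1 V hVm hV1
    hs₁lo.le hs₁0 hs₁₂ hs₂1 hVU' hη hN hNge rfl hη' hη'1 hη'2 hη'3 hδη hdR hk3.le v hv1 hvE hvL2
  -- lsc at `s₁` and division by `R`
  have hlsc := hk₁ k hk5
  have hdiv : (R (φ k) : ℝ)⁻¹ * ∑ y ∈ box (z (φ k)) ⌈s₁ * (R (φ k) : ℝ)⌉, ∑ μ : Fin 3, ‖u (φ k) (y + unitVec μ) - u (φ k) y‖ ^ 2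
      ≤ B + 3 * η / 4 := by
    rw [inv_mul_le_iff₀ hRr]
    exact hlev
  linarith [hlsc, hdiv]

end Summit.QuantumFields.YangMills.Theorems.PoincareLipschitzLatticeToContinuumMinimality

end
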